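import Mathlib
import HarnessLib
import Summits.ResolutionOfSingularities.ResolutionOfSingularities.Theorems.WildQuotientsWildQuotientResolutionS1aSymChartMemberLin
import Summits.ResolutionOfSingularities.ResolutionOfSingularities.Theorems.WildQuotientsWildQuotientResolutionS1aSymMemberInv

/-!
# S1a — THE LINE MEMBER ON A PRODUCER CHART for the σ-INVARIANT LINE (weights (1,1)), and the UNIFORM line member (either weight)

[OURS · L1 W4.5c · lead-1 g15; R3 (`lines_killsIn_two`, plan-1 RULING R-F15l (2)); bricks ✓`…S1aSymChartMemberLin` (weights (2,1), `a + b ≠ 0`) and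
✓`…S1aSymMemberInv` (abstract invariant member, weights (1,1))] — NOT statements of the manuscript; counted 0; AI-level work, weaker than expert review. Crux
stmt-ResolutionOfSingularities-17941 `CyclicQuotientFourfolds`, line `s1a-logminvertex` v13 (`stub_reachLowerInFX`).

* ★★★ `exists_isPrincipalCentre_of_symChartInv` — on a producer chart of the symmetric root (x₀ : δ+1, x₁ : 1, x₂ : 1; tail `t`, `e⁻¹t ∈ 𝒥_δ`, model tail
  `s^δ·T′`, `T′ = H·(a x₁′ + b x₂′)`, `H ∣ Ψ(c)`), for the INVARIANT line `a + b = 0`: the component `V(x₀′, a x₁′ + b x₂′)` is cut out by a PRINCIPAL centre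
  `(x₀′ : 1, a x₁′ + b x₂′ : 1; β = s^δ)` of a given Veronese degree (times `l`), chart `W`, support in `W` and off the separating opens;
* ★★★ `exists_isPrincipalCentre_of_symChartLine` — the same conclusion for ANY line, weights `(if a + b = 0 then 1 else 2, 1)` (case split between
  ✓`exists_isPrincipalCentre_of_symChartLin` and `exists_isPrincipalCentre_of_symChartInv`) — the form used uniformly in the chart index by `lines_killsIn_two`.
-/

set_option linter.dupNamespace false

noncomputable section

open CategoryTheory Limits AlgebraicGeometry TopologicalSpace Topology Opposite MvPolynomial
open Literature.AlgebraicGeometry.Resolution Literature.AlgebraicGeometry.RelativeSpec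
open scoped LaurentPolynomial
open Summit.ResolutionOfSingularities.ResolutionOfSingularities.Theorems.WildQuotientResolution.S1
open Summit.ResolutionOfSingularities.ResolutionOfSingularities.Theorems.WildQuotientResolution.S1.NodeAtlas
open Summit.ResolutionOfSingularities.ResolutionOfSingularities.Theorems.WildQuotientResolution.S1.CoarseChart
open Summit.ResolutionOfSingularities.ResolutionOfSingularities.Theorems.WildQuotientResolution.S1.ProducerStep
open Summit.ResolutionOfSingularities.ResolutionOfSingularities.Theorems.WildQuotientResolution.S1.NpFrame
open Summit.ResolutionOfSingularities.ResolutionOfSingularities.Theorems.WildQuotientResolution.S1.GoodCharts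
open Summit.ResolutionOfSingularities.ResolutionOfSingularities.Theorems.WildQuotientResolution.S1.BlowupCharts
open Summit.ResolutionOfSingularities.ResolutionOfSingularities.Theorems.WildQuotientResolution.S1.KillCert
open Summit.ResolutionOfSingularities.ResolutionOfSingularities.Theorems.WildQuotientResolution.S1.ReesBigrading
open Summit.ResolutionOfSingularities.ResolutionOfSingularities.Theorems.WildQuotientResolution.S1.NodeTransport
open Summit.ResolutionOfSingularities.ResolutionOfSingularities.Theorems.WildQuotientResolution.S1.CobordantTransport
open Summit.ResolutionOfSingularities.ResolutionOfSingularities.Theorems.WildQuotientResolution.S1.FreeModel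


namespace Summit.ResolutionOfSingularities.ResolutionOfSingularities.Theorems.WildQuotientResolution.S1.GameFrame.GModel

variable {p : ℕ} {X' X₁ : Scheme.{0}} {q : X' ⟶ X₁} {G : Type} [Group G] {ρ : G →* Aut X'} {g₀ : G}

set_option maxHeartbeats 8000000 in
set_option synthInstance.maxHeartbeats 400000 in
/-- ★★★ **THE INVARIANT-LINE MEMBER ON A PRODUCER CHART OF THE SYMMETRIC ROOT**: component `V(x₀′, a·x₁′ + b·x₂′)`, `a + b = 0`, weights (1,1). See the module docstring.
[OURS · L1 W4.5c · R3 second member type per chart; NOT a statement of the manuscript] -/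
theorem exists_isPrincipalCentre_of_symChartInv [Finite G] (hG : ∀ g : G, g ∈ Subgroup.zpowers g₀)
    {k : Type} [Field k] {A : Type} [CommRing A]
    (σ : MvPolynomial (Fin 4) k ≃+* MvPolynomial (Fin 4) k) (hC : ∀ a : k, σ (C a) = C a)
    (h0 : σ (X 0) = X 0) (h1 : σ (X 1) = X 1 + X 0) (h2 : σ (X 2) = X 2 + X 0) (δ : ℕ) (t : MvPolynomial (Fin 4) k)
    (h3 : σ (X 3) = X 3 + t) (e : A ≃+* MvPolynomial (Fin 4) k) (τ : A ≃+* A) (hact : ∀ x : A, τ x = e.symm (σ (e x)))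
    (ht : e.symm t ∈ (weightedFiltration (e.symm ∘ ![X 0, X 1, X 2] : Fin 3 → A) ![δ + 1, 1, 1]).ideal δ)
    (hp : 0 < p) (hσp : ∀ x : A, (⇑τ)^[p] x = x)
    (hσJ : ∀ n : ℕ, ((weightedFiltration (e.symm ∘ ![X 0, X 1, X 2] : Fin 3 → A) ![δ + 1, 1, 1]).ideal n).map (τ : A →+* A) ≤
      (weightedFiltration (e.symm ∘ ![X 0, X 1, X 2] : Fin 3 → A) ![δ + 1, 1, 1]).ideal n)
    {m : ℕ} (mo : Fin m → ℕ) (𝒜 : (Π j : Fin m, ZMod (mo j)) → AddSubgroup A) [GradedRing 𝒜]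
    (hf : ∀ i, (e.symm ∘ ![X 0, X 1, X 2] : Fin 3 → A) i ∈ 𝒜 ((fun _ => (0 : Π j : Fin m, ZMod (mo j))) i))
    (hC0 : ∀ c : k, e.symm (C c) ∈ 𝒜 0)
    {dbar : ℕ} (y : ↥(𝒜 0)) (hy : y ∈ (traceFiltration 𝒜 (e.symm ∘ ![X 0, X 1, X 2] : Fin 3 → A) ![δ + 1, 1, 1]).ideal dbar) (hσy : τ (y : A) = y)
    -- the pinned root model and the tail
    (Ψ : ↥(cobordantAlgebra (e.symm ∘ ![X 0, X 1, X 2] : Fin 3 → A) ![δ + 1, 1, 1]) ≃+* MvPolynomial (Option (Fin 4)) k)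
    (hΨa : ∀ a : MvPolynomial (Fin 4) k, Ψ (algebraMap A _ (e.symm a)) = cobordantAlgebra.subst k (![δ + 1, 1, 1, 0] : Fin 4 → ℕ) a)
    (hΨs : Ψ (cobordantAlgebra.s _ _) = X none)
    (hΨ0 : Ψ (cobordantAlgebra.u' (e.symm ∘ ![X 0, X 1, X 2] : Fin 3 → A) ![δ + 1, 1, 1] 0) = X (some 0))
    (hΨ1 : Ψ (cobordantAlgebra.u' (e.symm ∘ ![X 0, X 1, X 2] : Fin 3 → A) ![δ + 1, 1, 1] 1) = X (some 1))
    (hΨ2 : Ψ (cobordantAlgebra.u' (e.symm ∘ ![X 0, X 1, X 2] : Fin 3 → A) ![δ + 1, 1, 1] 2) = X (some 2))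
    (T' : MvPolynomial (Option (Fin 4)) k) (hT' : cobordantAlgebra.subst k (![δ + 1, 1, 1, 0] : Fin 4 → ℕ) t = X none ^ δ * T')
    -- the chart and its producer node
    (M : GModel p q G ρ g₀) [M.V.IsSeparated] (W : M.act.StableAffineOpens) (hW : IsAffineOpen W.1)
    (E : letI := chartNodeGradedRing mo 𝒜 (e.symm ∘ ![X 0, X 1, X 2] : Fin 3 → A) ![δ + 1, 1, 1] hf dbar y hy
      Γ(M.V, W.1) ≃+* ↥(chartNodeGrading mo 𝒜 (e.symm ∘ ![X 0, X 1, X 2] : Fin 3 → A) ![δ + 1, 1, 1] hf dbar y hy 0))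
    (htame : letI := chartNodeGradedRing mo 𝒜 (e.symm ∘ ![X 0, X 1, X 2] : Fin 3 → A) ![δ + 1, 1, 1] hf dbar y hy
      IsTameNode p (ChartRing 𝒜 (e.symm ∘ ![X 0, X 1, X 2] : Fin 3 → A) ![δ + 1, 1, 1] dbar y hy)
        (chartNodeGrading mo 𝒜 (e.symm ∘ ![X 0, X 1, X 2] : Fin 3 → A) ![δ + 1, 1, 1] hf dbar y hy)
        (sigmaChart 𝒜 (e.symm ∘ ![X 0, X 1, X 2] : Fin 3 → A) ![δ + 1, 1, 1] dbar y hy τ hσJ hp hσp hσy))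
    (hE : letI := chartNodeGradedRing mo 𝒜 (e.symm ∘ ![X 0, X 1, X 2] : Fin 3 → A) ![δ + 1, 1, 1] hf dbar y hy
      ∀ t' : Γ(M.V, W.1), ((E ((M.act.aut g₀⁻¹).hom.appLE W.1 W.1 (W.2.1 g₀⁻¹).ge t') :
          ↥(chartNodeGrading mo 𝒜 (e.symm ∘ ![X 0, X 1, X 2] : Fin 3 → A) ![δ + 1, 1, 1] hf dbar y hy 0)) :
            ChartRing 𝒜 (e.symm ∘ ![X 0, X 1, X 2] : Fin 3 → A) ![δ + 1, 1, 1] dbar y hy) =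
        sigmaChart 𝒜 (e.symm ∘ ![X 0, X 1, X 2] : Fin 3 → A) ![δ + 1, 1, 1] dbar y hy τ hσJ hp hσp hσy
          ((E t' : ↥(chartNodeGrading mo 𝒜 (e.symm ∘ ![X 0, X 1, X 2] : Fin 3 → A) ![δ + 1, 1, 1] hf dbar y hy 0)) :
            ChartRing 𝒜 (e.symm ∘ ![X 0, X 1, X 2] : Fin 3 → A) ![δ + 1, 1, 1] dbar y hy))
    -- the component variable `x_{jφ}`, the unit `H`, a point, the Veronese degree
    (a b : k) (hab : a ≠ 0 ∨ b ≠ 0) (hab0 : a + b = 0)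
    (H : MvPolynomial (Option (Fin 4)) k) (hXR : T' = H * (C a * X (some 1) + C b * X (some 2))) (hdvd : H ∣ Ψ (coverElement 𝒜 _ _ dbar y hy))
    (g : Option (Fin 4) → k) (hg0 : g (some 0) = 0) (hgL : a * g (some 1) + b * g (some 2) = 0) (hu : MvPolynomial.eval g (Ψ (coverElement 𝒜 _ _ dbar y hy)) ≠ 0)
    (d : ℕ) (l : ℕ) (hl : 0 < l)
    (hver : letI := chartNodeGradedRing mo 𝒜 (e.symm ∘ ![X 0, X 1, X 2] : Fin 3 → A) ![δ + 1, 1, 1] hf dbar y hy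
      letI := mapGradedRing (chartNodeGrading mo 𝒜 (e.symm ∘ ![X 0, X 1, X 2] : Fin 3 → A) ![δ + 1, 1, 1] hf dbar y hy) (chartRingEquivAway 𝒜 _ _ dbar y hy Ψ)
      VeroneseNormalised (mapGrading (chartNodeGrading mo 𝒜 (e.symm ∘ ![X 0, X 1, X 2] : Fin 3 → A) ![δ + 1, 1, 1] hf dbar y hy) (chartRingEquivAway 𝒜 _ _ dbar y hy Ψ))
        (![algebraMap (MvPolynomial (Option (Fin 4)) k) (Localization.Away (Ψ (coverElement 𝒜 _ _ dbar y hy))) (X (some 0)), algebraMap (MvPolynomial (Option (Fin 4)) k) (Localization.Away (Ψ (coverElement 𝒜 _ _ dbar y hy))) (C a * X (some 1) + C b * X (some 2) : MvPolynomial (Option (Fin 4)) k)] : Fin 2 → (Localization.Away (Ψ (coverElement 𝒜 _ _ dbar y hy))))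
        ![1, 1] d)
    -- separating sections
    {κ : Type} (U : κ → M.V.Opens) (hcov : ∀ x : M.V, x ∈ W.1 ∨ ∃ i, x ∈ U i) (u : κ → Γ(M.V, W.1))
    (v : κ → ↥(cobordantAlgebra (e.symm ∘ ![X 0, X 1, X 2] : Fin 3 → A) ![δ + 1, 1, 1]))
    (huv : letI := chartNodeGradedRing mo 𝒜 (e.symm ∘ ![X 0, X 1, X 2] : Fin 3 → A) ![δ + 1, 1, 1] hf dbar y hy
      ∀ i, ((E (u i) : ↥(chartNodeGrading mo 𝒜 (e.symm ∘ ![X 0, X 1, X 2] : Fin 3 → A) ![δ + 1, 1, 1] hf dbar y hy 0)) :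
          ChartRing 𝒜 (e.symm ∘ ![X 0, X 1, X 2] : Fin 3 → A) ![δ + 1, 1, 1] dbar y hy) =
        algebraMap _ (ChartRing 𝒜 (e.symm ∘ ![X 0, X 1, X 2] : Fin 3 → A) ![δ + 1, 1, 1] dbar y hy) (v i) * IsLocalization.Away.invSelf (coverElement 𝒜 _ _ dbar y hy))
    (hΨv : ∀ i, (X (some 0) : MvPolynomial (Option (Fin 4)) k) ∣ Ψ (v i) ∨ (C a * X (some 1) + C b * X (some 2) : MvPolynomial (Option (Fin 4)) k) ∣ Ψ (v i))
    (huU : ∀ i, ∀ x ∈ W.1, x ∈ U i → x ∈ M.V.basicOpen (u i)) :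
    letI := chartNodeGradedRing mo 𝒜 (e.symm ∘ ![X 0, X 1, X 2] : Fin 3 → A) ![δ + 1, 1, 1] hf dbar y hy
    letI := mapGradedRing (chartNodeGrading mo 𝒜 (e.symm ∘ ![X 0, X 1, X 2] : Fin 3 → A) ![δ + 1, 1, 1] hf dbar y hy) (chartRingEquivAway 𝒜 _ _ dbar y hy Ψ)
    ∃ J : ReesFiltration M.V, IsPrincipalCentre p M.act g₀ J (d * l) ∧ IsPrincipalCentreChart p M.act g₀ J (d * l) W ∧
      (((J.ideal (d * l)).support : Set M.V)) ⊆ (W.1 : Set M.V) ∧ (∀ i, Disjoint ((U i : Set M.V)) (((J.ideal (d * l)).support : Set M.V))) ∧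
      ∀ n, (J.filtration ⟨W.1, hW⟩).ideal n =
        ((traceFiltration (mapGrading (chartNodeGrading mo 𝒜 (e.symm ∘ ![X 0, X 1, X 2] : Fin 3 → A) ![δ + 1, 1, 1] hf dbar y hy) (chartRingEquivAway 𝒜 _ _ dbar y hy Ψ))
          (![algebraMap (MvPolynomial (Option (Fin 4)) k) (Localization.Away (Ψ (coverElement 𝒜 _ _ dbar y hy))) (X (some 0)), algebraMap (MvPolynomial (Option (Fin 4)) k) (Localization.Away (Ψ (coverElement 𝒜 _ _ dbar y hy))) (C a * X (some 1) + C b * X (some 2) : MvPolynomial (Option (Fin 4)) k)] : Fin 2 → (Localization.Away (Ψ (coverElement 𝒜 _ _ dbar y hy)))) ![1, 1]).ideal n).comap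
          ((E.trans (zeroRingEquiv (chartNodeGrading mo 𝒜 (e.symm ∘ ![X 0, X 1, X 2] : Fin 3 → A) ![δ + 1, 1, 1] hf dbar y hy) (chartRingEquivAway 𝒜 _ _ dbar y hy Ψ)) :
            Γ(M.V, W.1) ≃+* _) : Γ(M.V, W.1) →+* _) := by
  letI instN := chartNodeGradedRing mo 𝒜 (e.symm ∘ ![X 0, X 1, X 2] : Fin 3 → A) ![δ + 1, 1, 1] hf dbar y hy
  letI instP := mapGradedRing (chartNodeGrading mo 𝒜 (e.symm ∘ ![X 0, X 1, X 2] : Fin 3 → A) ![δ + 1, 1, 1] hf dbar y hy) (chartRingEquivAway 𝒜 _ _ dbar y hy Ψ)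
  have hver' := CoarseChart.veroneseNormalised_mul _ _ _ hver hl
  -- rows of `τ′ = conj Φ σ_chart` in the free model
  have rn := Sym.sym_model_row_none δ e τ hp hσp hσJ Ψ hΨs mo 𝒜 y hy hσy
  have r0 := Sym.sym_model_row_zero σ h0 δ e τ hact hp hσp hσJ Ψ hΨ0 mo 𝒜 y hy hσy
  have r1 := Sym.sym_model_row_one σ h1 δ e τ hact hp hσp hσJ Ψ hΨs hΨ0 hΨ1 mo 𝒜 y hy hσy
  have r2 := Sym.sym_model_row_two σ h2 δ e τ hact hp hσp hσJ Ψ hΨs hΨ0 hΨ2 mo 𝒜 y hy hσy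
  have r3 := Sym.symT_model_row_three σ δ t h3 e τ hact ht hp hσp hσJ Ψ hΨa hΨs mo 𝒜 y hy hσy T' hT'
  have rfix := Sym.sym_model_fixed σ hC δ e τ hact hp hσp hσJ Ψ hΨa mo 𝒜 y hy hσy
  have dg0 := Sym.sym_model_degree_zero δ e Ψ hΨ0 mo 𝒜 hf y hy
  -- constants are fixed; the component `φ = a·x₁′ + b·x₂′`: row and degree
  have hCfix : ∀ c : k, conj (chartRingEquivAway 𝒜 _ _ dbar y hy Ψ) (sigmaChart 𝒜 _ _ dbar y hy τ hσJ hp hσp hσy) (algebraMap (MvPolynomial (Option (Fin 4)) k) (Localization.Away (Ψ (coverElement 𝒜 _ _ dbar y hy))) (C c)) = algebraMap (MvPolynomial (Option (Fin 4)) k) (Localization.Away (Ψ (coverElement 𝒜 _ _ dbar y hy))) (C c) := fun c => by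
    have h := rfix (algebraMap k (Localization.Away (Ψ (coverElement 𝒜 _ _ dbar y hy))) c) (Set.mem_union_right _ ⟨c, rfl⟩)
    rwa [IsScalarTower.algebraMap_apply k (MvPolynomial (Option (Fin 4)) k) (Localization.Away (Ψ (coverElement 𝒜 _ _ dbar y hy))) c, MvPolynomial.algebraMap_eq] at h
  have hba : (C b : MvPolynomial (Option (Fin 4)) k) = -C a := by rw [← map_neg]; congr 1; linear_combination hab0
  have hφrow : conj (chartRingEquivAway 𝒜 _ _ dbar y hy Ψ) (sigmaChart 𝒜 _ _ dbar y hy τ hσJ hp hσp hσy) (algebraMap (MvPolynomial (Option (Fin 4)) k) (Localization.Away (Ψ (coverElement 𝒜 _ _ dbar y hy))) (C a * X (some 1) + C b * X (some 2) : MvPolynomial (Option (Fin 4)) k)) =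
      algebraMap (MvPolynomial (Option (Fin 4)) k) (Localization.Away (Ψ (coverElement 𝒜 _ _ dbar y hy))) (C a * X (some 1) + C b * X (some 2) : MvPolynomial (Option (Fin 4)) k) := by
    simp only [map_add, map_mul, hCfix, r1, r2, hba, map_neg]
    ring
  have hφd := sym_model_degree_linForm δ e Ψ hΨa hΨ1 hΨ2 mo 𝒜 hf hC0 y hy a b
  -- K1′ by linear re-coordination
  obtain ⟨hK1, hK1'⟩ := FreeModel.isRegular_away_X_linForm k (Ψ (coverElement 𝒜 _ _ dbar y hy)) (some 0) (some 1) (some 2) (by decide) (by decide) (by decide)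
    a b hab g hg0 hgL hu
  have hXR' : algebraMap (MvPolynomial (Option (Fin 4)) k) (Localization.Away (Ψ (coverElement 𝒜 _ _ dbar y hy))) T' = algebraMap (MvPolynomial (Option (Fin 4)) k) (Localization.Away (Ψ (coverElement 𝒜 _ _ dbar y hy))) H * algebraMap (MvPolynomial (Option (Fin 4)) k) (Localization.Away (Ψ (coverElement 𝒜 _ _ dbar y hy))) (C a * X (some 1) + C b * X (some 2) : MvPolynomial (Option (Fin 4)) k) := by
    rw [← map_mul, hXR]
  have huJ : ∀ i, chartRingEquivAway 𝒜 _ _ dbar y hy Ψ ((E (u i) : ↥(chartNodeGrading mo 𝒜 (e.symm ∘ ![X 0, X 1, X 2] : Fin 3 → A) ![δ + 1, 1, 1] hf dbar y hy 0)) :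
        ChartRing 𝒜 (e.symm ∘ ![X 0, X 1, X 2] : Fin 3 → A) ![δ + 1, 1, 1] dbar y hy) ∈
      (weightedFiltration (![algebraMap (MvPolynomial (Option (Fin 4)) k) (Localization.Away (Ψ (coverElement 𝒜 _ _ dbar y hy))) (X (some 0)), algebraMap (MvPolynomial (Option (Fin 4)) k) (Localization.Away (Ψ (coverElement 𝒜 _ _ dbar y hy))) (C a * X (some 1) + C b * X (some 2) : MvPolynomial (Option (Fin 4)) k)] : Fin 2 → (Localization.Away (Ψ (coverElement 𝒜 _ _ dbar y hy)))) ![1, 1]).ideal 1 := by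
    intro i
    rw [huv i, chartRingEquivAway_algebraMap_mul_invSelf]
    refine Ideal.mul_mem_right _ _ ?_
    rcases hΨv i with h | h
    · exact Ideal.mem_of_dvd _ (map_dvd _ h) (mem_weightedFiltration_ideal (![algebraMap (MvPolynomial (Option (Fin 4)) k) (Localization.Away (Ψ (coverElement 𝒜 _ _ dbar y hy))) (X (some 0)), algebraMap (MvPolynomial (Option (Fin 4)) k) (Localization.Away (Ψ (coverElement 𝒜 _ _ dbar y hy))) (C a * X (some 1) + C b * X (some 2) : MvPolynomial (Option (Fin 4)) k)] : Fin 2 → (Localization.Away (Ψ (coverElement 𝒜 _ _ dbar y hy)))) ![1, 1] 0)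
    · exact Ideal.mem_of_dvd _ (map_dvd _ h) (mem_weightedFiltration_ideal (![algebraMap (MvPolynomial (Option (Fin 4)) k) (Localization.Away (Ψ (coverElement 𝒜 _ _ dbar y hy))) (X (some 0)), algebraMap (MvPolynomial (Option (Fin 4)) k) (Localization.Away (Ψ (coverElement 𝒜 _ _ dbar y hy))) (C a * X (some 1) + C b * X (some 2) : MvPolynomial (Option (Fin 4)) k)] : Fin 2 → (Localization.Away (Ψ (coverElement 𝒜 _ _ dbar y hy)))) ![1, 1] 1)
  exact exists_isPrincipalCentre_of_symMemberInv hG M W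
    ({ affine := hW, m := m + 1, r := Fin.cons 0 mo, B := ChartRing 𝒜 (e.symm ∘ ![X 0, X 1, X 2] : Fin 3 → A) ![δ + 1, 1, 1] dbar y hy,
       𝒜 := chartNodeGrading mo 𝒜 (e.symm ∘ ![X 0, X 1, X 2] : Fin 3 → A) ![δ + 1, 1, 1] hf dbar y hy,
       σ := sigmaChart 𝒜 (e.symm ∘ ![X 0, X 1, X 2] : Fin 3 → A) ![δ + 1, 1, 1] dbar y hy τ hσJ hp hσp hσy,
       e := E, tame := htame, intertwine := hE } : NodeData p M.act g₀ W)
    (chartRingEquivAway 𝒜 _ _ dbar y hy Ψ)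
    (conj (chartRingEquivAway 𝒜 _ _ dbar y hy Ψ) (sigmaChart 𝒜 _ _ dbar y hy τ hσJ hp hσp hσy)) (fun _ => rfl)
    (algebraMap (MvPolynomial (Option (Fin 4)) k) (Localization.Away (Ψ (coverElement 𝒜 _ _ dbar y hy))) (X none)) (algebraMap (MvPolynomial (Option (Fin 4)) k) (Localization.Away (Ψ (coverElement 𝒜 _ _ dbar y hy))) (X (some 0))) (algebraMap (MvPolynomial (Option (Fin 4)) k) (Localization.Away (Ψ (coverElement 𝒜 _ _ dbar y hy))) (X (some 1))) (algebraMap (MvPolynomial (Option (Fin 4)) k) (Localization.Away (Ψ (coverElement 𝒜 _ _ dbar y hy))) (X (some 2))) (algebraMap (MvPolynomial (Option (Fin 4)) k) (Localization.Away (Ψ (coverElement 𝒜 _ _ dbar y hy))) (X (some 3)))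
    (algebraMap (MvPolynomial (Option (Fin 4)) k) (Localization.Away (Ψ (coverElement 𝒜 _ _ dbar y hy))) (C a * X (some 1) + C b * X (some 2) : MvPolynomial (Option (Fin 4)) k)) (algebraMap (MvPolynomial (Option (Fin 4)) k) (Localization.Away (Ψ (coverElement 𝒜 _ _ dbar y hy))) T') (algebraMap (MvPolynomial (Option (Fin 4)) k) (Localization.Away (Ψ (coverElement 𝒜 _ _ dbar y hy))) H)
    (1 : k) (1 : k) δ _ rn r0 (by rw [map_one, one_mul]; exact r1) (by rw [map_one, one_mul]; exact r2) r3 hφrow one_ne_zero hXR'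
    (IsLocalization.Away.isUnit_of_dvd _ hdvd) rfix (A1.a1_model_closure_eq_top _) hK1 hK1' _ _ dg0 hφd (d * l) (Nat.mul_pos hver.1 hl) hver' U hcov u
    (fun _ => 1) (fun _ => one_pos) huJ huU

set_option maxHeartbeats 4000000 in
set_option synthInstance.maxHeartbeats 400000 in
open scoped Classical in
/-- ★★★ **THE LINE MEMBER ON A PRODUCER CHART OF THE SYMMETRIC ROOT, EITHER WEIGHT**: component `V(x₀′, a·x₁′ + b·x₂′)` for ANY line, weights
`(if a + b = 0 then 1 else 2, 1)`. See the module docstring. [OURS · L1 W4.5c · R3 uniform line member per chart; NOT a statement of the manuscript] -/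
theorem exists_isPrincipalCentre_of_symChartLine [Finite G] (hG : ∀ g : G, g ∈ Subgroup.zpowers g₀)
    {k : Type} [Field k] {A : Type} [CommRing A]
    (σ : MvPolynomial (Fin 4) k ≃+* MvPolynomial (Fin 4) k) (hC : ∀ a : k, σ (C a) = C a)
    (h0 : σ (X 0) = X 0) (h1 : σ (X 1) = X 1 + X 0) (h2 : σ (X 2) = X 2 + X 0) (δ : ℕ) (t : MvPolynomial (Fin 4) k)
    (h3 : σ (X 3) = X 3 + t) (e : A ≃+* MvPolynomial (Fin 4) k) (τ : A ≃+* A) (hact : ∀ x : A, τ x = e.symm (σ (e x)))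
    (ht : e.symm t ∈ (weightedFiltration (e.symm ∘ ![X 0, X 1, X 2] : Fin 3 → A) ![δ + 1, 1, 1]).ideal δ)
    (hp : 0 < p) (hσp : ∀ x : A, (⇑τ)^[p] x = x)
    (hσJ : ∀ n : ℕ, ((weightedFiltration (e.symm ∘ ![X 0, X 1, X 2] : Fin 3 → A) ![δ + 1, 1, 1]).ideal n).map (τ : A →+* A) ≤
      (weightedFiltration (e.symm ∘ ![X 0, X 1, X 2] : Fin 3 → A) ![δ + 1, 1, 1]).ideal n)
    {m : ℕ} (mo : Fin m → ℕ) (𝒜 : (Π j : Fin m, ZMod (mo j)) → AddSubgroup A) [GradedRing 𝒜]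
    (hf : ∀ i, (e.symm ∘ ![X 0, X 1, X 2] : Fin 3 → A) i ∈ 𝒜 ((fun _ => (0 : Π j : Fin m, ZMod (mo j))) i))
    (hC0 : ∀ c : k, e.symm (C c) ∈ 𝒜 0)
    {dbar : ℕ} (y : ↥(𝒜 0)) (hy : y ∈ (traceFiltration 𝒜 (e.symm ∘ ![X 0, X 1, X 2] : Fin 3 → A) ![δ + 1, 1, 1]).ideal dbar) (hσy : τ (y : A) = y)
    -- the pinned root model and the tail
    (Ψ : ↥(cobordantAlgebra (e.symm ∘ ![X 0, X 1, X 2] : Fin 3 → A) ![δ + 1, 1, 1]) ≃+* MvPolynomial (Option (Fin 4)) k)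
    (hΨa : ∀ a : MvPolynomial (Fin 4) k, Ψ (algebraMap A _ (e.symm a)) = cobordantAlgebra.subst k (![δ + 1, 1, 1, 0] : Fin 4 → ℕ) a)
    (hΨs : Ψ (cobordantAlgebra.s _ _) = X none)
    (hΨ0 : Ψ (cobordantAlgebra.u' (e.symm ∘ ![X 0, X 1, X 2] : Fin 3 → A) ![δ + 1, 1, 1] 0) = X (some 0))
    (hΨ1 : Ψ (cobordantAlgebra.u' (e.symm ∘ ![X 0, X 1, X 2] : Fin 3 → A) ![δ + 1, 1, 1] 1) = X (some 1))
    (hΨ2 : Ψ (cobordantAlgebra.u' (e.symm ∘ ![X 0, X 1, X 2] : Fin 3 → A) ![δ + 1, 1, 1] 2) = X (some 2))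
    (T' : MvPolynomial (Option (Fin 4)) k) (hT' : cobordantAlgebra.subst k (![δ + 1, 1, 1, 0] : Fin 4 → ℕ) t = X none ^ δ * T')
    -- the chart and its producer node
    (M : GModel p q G ρ g₀) [M.V.IsSeparated] (W : M.act.StableAffineOpens) (hW : IsAffineOpen W.1)
    (E : letI := chartNodeGradedRing mo 𝒜 (e.symm ∘ ![X 0, X 1, X 2] : Fin 3 → A) ![δ + 1, 1, 1] hf dbar y hy
      Γ(M.V, W.1) ≃+* ↥(chartNodeGrading mo 𝒜 (e.symm ∘ ![X 0, X 1, X 2] : Fin 3 → A) ![δ + 1, 1, 1] hf dbar y hy 0))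
    (htame : letI := chartNodeGradedRing mo 𝒜 (e.symm ∘ ![X 0, X 1, X 2] : Fin 3 → A) ![δ + 1, 1, 1] hf dbar y hy
      IsTameNode p (ChartRing 𝒜 (e.symm ∘ ![X 0, X 1, X 2] : Fin 3 → A) ![δ + 1, 1, 1] dbar y hy)
        (chartNodeGrading mo 𝒜 (e.symm ∘ ![X 0, X 1, X 2] : Fin 3 → A) ![δ + 1, 1, 1] hf dbar y hy)
        (sigmaChart 𝒜 (e.symm ∘ ![X 0, X 1, X 2] : Fin 3 → A) ![δ + 1, 1, 1] dbar y hy τ hσJ hp hσp hσy))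
    (hE : letI := chartNodeGradedRing mo 𝒜 (e.symm ∘ ![X 0, X 1, X 2] : Fin 3 → A) ![δ + 1, 1, 1] hf dbar y hy
      ∀ t' : Γ(M.V, W.1), ((E ((M.act.aut g₀⁻¹).hom.appLE W.1 W.1 (W.2.1 g₀⁻¹).ge t') :
          ↥(chartNodeGrading mo 𝒜 (e.symm ∘ ![X 0, X 1, X 2] : Fin 3 → A) ![δ + 1, 1, 1] hf dbar y hy 0)) :
            ChartRing 𝒜 (e.symm ∘ ![X 0, X 1, X 2] : Fin 3 → A) ![δ + 1, 1, 1] dbar y hy) =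
        sigmaChart 𝒜 (e.symm ∘ ![X 0, X 1, X 2] : Fin 3 → A) ![δ + 1, 1, 1] dbar y hy τ hσJ hp hσp hσy
          ((E t' : ↥(chartNodeGrading mo 𝒜 (e.symm ∘ ![X 0, X 1, X 2] : Fin 3 → A) ![δ + 1, 1, 1] hf dbar y hy 0)) :
            ChartRing 𝒜 (e.symm ∘ ![X 0, X 1, X 2] : Fin 3 → A) ![δ + 1, 1, 1] dbar y hy))
    -- the component variable `x_{jφ}`, the unit `H`, a point, the Veronese degree
    (a b : k) (hab : a ≠ 0 ∨ b ≠ 0)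
    (H : MvPolynomial (Option (Fin 4)) k) (hXR : T' = H * (C a * X (some 1) + C b * X (some 2))) (hdvd : H ∣ Ψ (coverElement 𝒜 _ _ dbar y hy))
    (g : Option (Fin 4) → k) (hg0 : g (some 0) = 0) (hgL : a * g (some 1) + b * g (some 2) = 0) (hu : MvPolynomial.eval g (Ψ (coverElement 𝒜 _ _ dbar y hy)) ≠ 0)
    (d : ℕ) (l : ℕ) (hl : 0 < l)
    (hver : letI := chartNodeGradedRing mo 𝒜 (e.symm ∘ ![X 0, X 1, X 2] : Fin 3 → A) ![δ + 1, 1, 1] hf dbar y hy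
      letI := mapGradedRing (chartNodeGrading mo 𝒜 (e.symm ∘ ![X 0, X 1, X 2] : Fin 3 → A) ![δ + 1, 1, 1] hf dbar y hy) (chartRingEquivAway 𝒜 _ _ dbar y hy Ψ)
      VeroneseNormalised (mapGrading (chartNodeGrading mo 𝒜 (e.symm ∘ ![X 0, X 1, X 2] : Fin 3 → A) ![δ + 1, 1, 1] hf dbar y hy) (chartRingEquivAway 𝒜 _ _ dbar y hy Ψ))
        (![algebraMap (MvPolynomial (Option (Fin 4)) k) (Localization.Away (Ψ (coverElement 𝒜 _ _ dbar y hy))) (X (some 0)), algebraMap (MvPolynomial (Option (Fin 4)) k) (Localization.Away (Ψ (coverElement 𝒜 _ _ dbar y hy))) (C a * X (some 1) + C b * X (some 2) : MvPolynomial (Option (Fin 4)) k)] : Fin 2 → (Localization.Away (Ψ (coverElement 𝒜 _ _ dbar y hy))))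
        ![if a + b = 0 then 1 else 2, 1] d)
    -- separating sections
    {κ : Type} (U : κ → M.V.Opens) (hcov : ∀ x : M.V, x ∈ W.1 ∨ ∃ i, x ∈ U i) (u : κ → Γ(M.V, W.1))
    (v : κ → ↥(cobordantAlgebra (e.symm ∘ ![X 0, X 1, X 2] : Fin 3 → A) ![δ + 1, 1, 1]))
    (huv : letI := chartNodeGradedRing mo 𝒜 (e.symm ∘ ![X 0, X 1, X 2] : Fin 3 → A) ![δ + 1, 1, 1] hf dbar y hy
      ∀ i, ((E (u i) : ↥(chartNodeGrading mo 𝒜 (e.symm ∘ ![X 0, X 1, X 2] : Fin 3 → A) ![δ + 1, 1, 1] hf dbar y hy 0)) :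
          ChartRing 𝒜 (e.symm ∘ ![X 0, X 1, X 2] : Fin 3 → A) ![δ + 1, 1, 1] dbar y hy) =
        algebraMap _ (ChartRing 𝒜 (e.symm ∘ ![X 0, X 1, X 2] : Fin 3 → A) ![δ + 1, 1, 1] dbar y hy) (v i) * IsLocalization.Away.invSelf (coverElement 𝒜 _ _ dbar y hy))
    (hΨv : ∀ i, (X (some 0) : MvPolynomial (Option (Fin 4)) k) ∣ Ψ (v i) ∨ (C a * X (some 1) + C b * X (some 2) : MvPolynomial (Option (Fin 4)) k) ∣ Ψ (v i))
    (huU : ∀ i, ∀ x ∈ W.1, x ∈ U i → x ∈ M.V.basicOpen (u i)) :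
    ∃ J : ReesFiltration M.V, IsPrincipalCentre p M.act g₀ J (d * l) ∧ IsPrincipalCentreChart p M.act g₀ J (d * l) W ∧
      (((J.ideal (d * l)).support : Set M.V)) ⊆ (W.1 : Set M.V) ∧ (∀ i, Disjoint ((U i : Set M.V)) (((J.ideal (d * l)).support : Set M.V))) := by
  by_cases hab0 : a + b = 0
  · rw [if_pos hab0] at hver
    obtain ⟨J, hJ, hJW, hJsupp, hJoff, -⟩ := exists_isPrincipalCentre_of_symChartInv hG σ hC h0 h1 h2 δ t h3 e τ hact ht hp hσp hσJ mo 𝒜 hf hC0 y hy hσy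
      Ψ hΨa hΨs hΨ0 hΨ1 hΨ2 T' hT' M W hW E htame hE a b hab hab0 H hXR hdvd g hg0 hgL hu d l hl hver U hcov u v huv hΨv huU
    exact ⟨J, hJ, hJW, hJsupp, hJoff⟩
  · rw [if_neg hab0] at hver
    obtain ⟨J, hJ, hJW, hJsupp, hJoff, -⟩ := exists_isPrincipalCentre_of_symChartLin hG σ hC h0 h1 h2 δ t h3 e τ hact ht hp hσp hσJ mo 𝒜 hf hC0 y hy hσy
      Ψ hΨa hΨs hΨ0 hΨ1 hΨ2 T' hT' M W hW E htame hE a b hab hab0 H hXR hdvd g hg0 hgL hu d l hl hver U hcov u v huv hΨv huU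
    exact ⟨J, hJ, hJW, hJsupp, hJoff⟩

end Summit.ResolutionOfSingularities.ResolutionOfSingularities.Theorems.WildQuotientResolution.S1.GameFrame.GModel

end
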